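import Summits.Schanuel.Schanuel.Theorems.DiophantineDichotomyApproximationPropertyCycleAPThreePrimeOfCurve
import Summits.Schanuel.Schanuel.Theorems.DiophantineDichotomyApproximationPropertyElimCISpace
import Mathlib.RingTheory.Ideal.AssociatedPrime.Basic
import HarnessLib

/-!
# The clause-free `t = 3` descent with its complete-intersection dichotomy exposed (crux `ApproximationProperty`, stmt-Schanuel-6117)

Crux `stmt-Schanuel-6117` (`Summit.Schanuel.Schanuel.Theses.DiophantineDichotomy.ApproximationProperty`),
line `orbit-interpolation-determinant`, registered stub `cycleAP3_dichotomy_of`.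

This is the construction of the landed cut 3 (`cycleAP3Prime_of_curve`,
`CycleAP3PrimeOfCurve.cut3`) run once more, but with ALL of its objects exposed: from

* (SPC3) a small homogeneous prime space curve `𝔮 ⊇ (Q, P)` through a complete intersection
  (`(Q)` prime of degree `a ≤ Δ`, `P ∉ (Q)` of degree `b ≤ 2Δ`) (hypothesis; neighbour stub
  `smallPrimeCurve3_of`);
* (H2) the Hilbert-function lower bound `H(𝔮; ν) ≥ (ν − a − b) deg 𝔮` for `ν ≥ a + b`
  (hypothesis; neighbour stub `curveHilbert_lowerBound`),

we produce, for every `ω ∈ ℂ³` and all scales `c ≤ Δ ≤ Y`, the surface `Q`, the form `P`, the curve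
`𝔮`, the THIRD FORM `T = P₃ ∉ 𝔮` of degree `τ = a + b + ⌊Δ⌋ ≤ 4Δ` (box principle modulo `𝔮`,
`boxPrinciple_modIdeal`, with the adaptive height of the template) and the ORBIT `𝔭 ⊇ 𝔮 + (T)`
selected by `small_prime_of_cut` (`m = 3`, `r = 2`), with the three `CycleAP3Prime` bounds, AND the
dichotomy: either `T` is a non-zero-divisor modulo `(Q, P)` — then `(Q, P, T)` is a complete
intersection of dimension `0` and the landed `elim_ciSpace` gives the interpolation clause
`dim S_s = dim 𝔭_s + deg 𝔭` for every `s ≥ a + b + τ` — or `T` lies in an associated prime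
`𝔯 ≠ 𝔮` of `S/(Q, P)` (zero-divisors of a module over a Noetherian ring are the union of its
associated primes, `biUnion_associatedPrimes_eq_zero_divisors`). Bookkeeping over landed theorems;
proofs only, no definitions. Sources: Philippon, J. Number Theory 81 (2000) (AP1, `n = 3`);
Nesterenko–Philippon (eds.), LNM 1752 (2001), Ch. 3 §4–§5.
-/

set_option linter.dupNamespace false

noncomputable section

namespace Summit.Schanuel.Schanuel.Cruxes.ApproximationProperty.OrbitInterpolationDeterminant

open Literature.NumberTheory.Transcendental Literature.NumberTheory.Transcendental.Nesterenko
open Literature.NumberTheory.Transcendental.PhilipponMain (cons_one_ne_zero one_le_norm_cons_one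
  ringKrullDim_quotient_eq_of_isUnmixedOfRank)
open MvPolynomial Real Module
open Literature.RingTheory.MvPolynomial (idealDegree)
open scoped BigOperators

attribute [local instance] MvPolynomial.gradedAlgebra

namespace CycleAP3Dichotomy

/-! ## Zero-divisors and associated primes -/

/-- **A zero-divisor modulo `J` lies in some associated prime of `R ⧸ J`** (Noetherian `R`; the
zero-divisors of a module are the union of its associated primes). [folklore] -/
theorem exists_mem_associatedPrimes_of_not_nzd {R : Type*} [CommRing R] [IsNoetherianRing R]
    {J : Ideal R} {x : R} (hx : ¬ ∀ f, x * f ∈ J → f ∈ J) :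
    ∃ 𝔯 ∈ associatedPrimes R (R ⧸ J), x ∈ 𝔯 := by
  by_contra hcon
  refine hx fun f hf => ?_
  by_contra hfJ
  have hmk : Ideal.Quotient.mk J f ≠ 0 := mt Ideal.Quotient.eq_zero_iff_mem.mp hfJ
  have hzero : x • Ideal.Quotient.mk J f = 0 := by
    rw [Algebra.smul_def, Ideal.Quotient.algebraMap_eq, ← map_mul, Ideal.Quotient.eq_zero_iff_mem]
    exact hf
  have hmem : x ∈ {r : R | ∃ y : R ⧸ J, y ≠ 0 ∧ r • y = 0} := ⟨_, hmk, hzero⟩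
  rw [← biUnion_associatedPrimes_eq_zero_divisors] at hmem
  obtain ⟨𝔯, h𝔯, hx𝔯⟩ := Set.mem_iUnion₂.mp hmem
  exact hcon ⟨𝔯, h𝔯, hx𝔯⟩

/-! ## The dichotomy of the third cut -/

/-- **The complete-intersection dichotomy of the third cut.** For the surface `Q`, the form `P ∉ (Q)`,
the curve `𝔮 ∋ Q, P`, a third form `T ∉ 𝔮` of degree `τ` and a homogeneous prime `𝔭 ⊇ 𝔮 + (T)` of
rank `1`: either `T` is a non-zero-divisor modulo `(Q, P)`, and then the orbit `𝔭` (whose zeros lie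
on `V(Q) ∩ V(P) ∩ V(T)`) imposes independent conditions on the forms of every degree
`s ≥ a + b + τ` (`elim_ciSpace`), or `T` lies in an associated prime `𝔯 ≠ 𝔮` of `S/(Q, P)`.
[cite: NesterenkoPhilippon2001, Ch. 3 §5 (p. 42), Ch. 10 §3 (proof of Prop. 3.6)] -/
theorem dichotomy {Q P T : Rx 3} {a b τ : ℕ} {𝔮 𝔭 : Ideal (Rx 3)} (hQ0 : Q ≠ 0)
    (hQ : Q.IsHomogeneous a) (hP : P.IsHomogeneous b) (hT : T.IsHomogeneous τ) (ha : 1 ≤ a)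
    (hb : 1 ≤ b) (hτ : 1 ≤ τ) (hprime : (Ideal.span {Q}).IsPrime) (hPQ : P ∉ Ideal.span {Q})
    (hTq : T ∉ 𝔮) (hQq : Q ∈ 𝔮) (hPq : P ∈ 𝔮) (h𝔭 : 𝔭.IsPrime)
    (h𝔭hom : 𝔭.IsHomogeneous (homogeneousSubmodule (Fin (3 + 1)) ℚ))
    (h𝔭unm : IsUnmixedOfRank 𝔭 1) (hq𝔭 : 𝔮 ≤ 𝔭) (hT𝔭 : T ∈ 𝔭) :
    (∀ s : ℕ, a + b + τ ≤ s → finrank ℚ ↥(homogeneousSubmodule (Fin (3 + 1)) ℚ s) =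
        finrank ℚ ↥(homogeneousSubmodule (Fin (3 + 1)) ℚ s ⊓ 𝔭.restrictScalars ℚ) + ideg 𝔭 1) ∨
      (∃ 𝔯 ∈ associatedPrimes (Rx 3) (Rx 3 ⧸ (Ideal.span {Q} ⊔ Ideal.span {P})),
        𝔯 ≠ 𝔮 ∧ T ∈ 𝔯) := by
  by_cases hnzd :
      ∀ f, T * f ∈ Ideal.span {Q} ⊔ Ideal.span {P} → f ∈ Ideal.span {Q} ⊔ Ideal.span {P}
  · refine Or.inl fun s hs => ?_
    have hle : Ideal.span {Q} ⊔ Ideal.span {P} ⊔ Ideal.span {T} ≤ 𝔭 :=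
      sup_le (sup_le ((Ideal.span_singleton_le_iff_mem _).mpr (hq𝔭 hQq))
        ((Ideal.span_singleton_le_iff_mem _).mpr (hq𝔭 hPq)))
        ((Ideal.span_singleton_le_iff_mem _).mpr hT𝔭)
    exact (elim_ciSpace Q P T a b τ hQ0 hQ hP hT ha hb hτ hprime hPQ hnzd).2 𝔭 h𝔭
      (fun F hF k => MvPolynomial.homogeneousComponent_mem_of_mem h𝔭hom hF k) h𝔭unm
      (CycleAPITwo.projZeros_antitone hle) s hs
  · obtain ⟨𝔯, h𝔯, hT𝔯⟩ := exists_mem_associatedPrimes_of_not_nzd hnzd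
    exact Or.inr ⟨𝔯, h𝔯, fun h => hTq (h ▸ hT𝔯), hT𝔯⟩

/-! ## The assembly -/

/-- **Cut 3 of the clause-free descent in `ℙ³` with all its objects exposed** (curried form of the
registered stub): from the small prime space curve (SPC3) and the Hilbert lower bound (H2), for
every `ω ∈ ℂ³` a constant `c = 5000(c₂ + 1)(c_B + 1)` such that for `c ≤ Δ ≤ Y` the surface `Q`,
the form `P`, the curve `𝔮`, the third form `T ∉ 𝔮` of degree `τ ≤ 4Δ` (box principle modulo the
curve with the adaptive height) and the orbit `𝔭 ⊇ 𝔮 + (T)` of `small_prime_of_cut` (`m = 3`,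
`r = 2`, weights `(Δ, Y)`) satisfy `deg 𝔭 ≤ (cΔ)³`, `h(𝔭) ≤ c Y Δ²`,
`log |𝔭(1:ω)| ≤ −(Δ h(𝔭) + Y deg 𝔭)/c` and the complete-intersection dichotomy
(`CycleAP3Dichotomy.dichotomy`).
[cite: NesterenkoPhilippon2001, Ch. 3 Prop. 4.7, Prop. 4.11, Prop. 4.13 (pp. 39–41), §5 (p. 42)] -/
theorem cut3_exposed
    (hS : ∀ ω : Fin 3 → ℂ, ∃ c : ℝ, 1 ≤ c ∧ ∀ Δ Y : ℝ, c ≤ Δ → Δ ≤ Y →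
      ∃ (Q : Rx 3) (a : ℕ) (P : Rx 3) (b : ℕ) (𝔮 : Ideal (Rx 3)), Q ≠ 0 ∧ Q.IsHomogeneous a ∧
        1 ≤ a ∧ (a : ℝ) ≤ Δ ∧ (Ideal.span {Q}).IsPrime ∧ P.IsHomogeneous b ∧ 1 ≤ b ∧
        (b : ℝ) ≤ 2 * Δ ∧ P ∉ Ideal.span {Q} ∧ 𝔮.IsPrime ∧
        𝔮.IsHomogeneous (homogeneousSubmodule (Fin (3 + 1)) ℚ) ∧ IsUnmixedOfRank 𝔮 2 ∧ Q ∈ 𝔮 ∧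
        P ∈ 𝔮 ∧ (ideg 𝔮 2 : ℝ) ≤ 2 * Δ ^ 2 ∧ iheight 𝔮 2 ≤ c * Δ * Y ∧
        iabs 𝔮 2 (Fin.cons 1 ω) ≤ Real.exp (-(Δ / c * (Δ * iheight 𝔮 2 + Y * ideg 𝔮 2))))
    (hH : ∀ (Q P : Rx 3) (a b : ℕ), Q ≠ 0 → Q.IsHomogeneous a → P.IsHomogeneous b → 1 ≤ a →
      1 ≤ b → (Ideal.span {Q}).IsPrime → P ∉ Ideal.span {Q} → ∀ 𝔭 : Ideal (Rx 3), 𝔭.IsPrime →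
      (letI := MvPolynomial.gradedAlgebra (σ := Fin (3 + 1)) (R := ℚ);
        𝔭.IsHomogeneous (MvPolynomial.homogeneousSubmodule (Fin (3 + 1)) ℚ)) → Q ∈ 𝔭 → P ∈ 𝔭 →
      ringKrullDim (Rx 3 ⧸ 𝔭) = (2 : ℕ) → ∀ ν : ℕ, a + b ≤ ν →
      (ν - a - b) * Literature.NumberTheory.Transcendental.Nesterenko.ideg 𝔭 2 +
        Module.finrank ℚ ↥(Literature.RingTheory.MvPolynomial.idealDegree 𝔭 ν) ≤
        Module.finrank ℚ ↥(MvPolynomial.homogeneousSubmodule (Fin (3 + 1)) ℚ ν))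
    (ω : Fin 3 → ℂ) :
    ∃ c : ℝ, 1 ≤ c ∧ ∀ Δ Y : ℝ, c ≤ Δ → Δ ≤ Y → ∃ (Q : Rx 3) (a : ℕ) (P : Rx 3) (b : ℕ)
      (T : Rx 3) (τ : ℕ) (𝔮 𝔭 : Ideal (Rx 3)), Q ≠ 0 ∧ Q.IsHomogeneous a ∧ 1 ≤ a ∧ (a : ℝ) ≤ Δ ∧
      (Ideal.span {Q}).IsPrime ∧ P.IsHomogeneous b ∧ 1 ≤ b ∧ (b : ℝ) ≤ 2 * Δ ∧
      P ∉ Ideal.span {Q} ∧ T.IsHomogeneous τ ∧ 1 ≤ τ ∧ (τ : ℝ) ≤ 4 * Δ ∧ T ∉ 𝔮 ∧ 𝔮.IsPrime ∧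
      𝔮.IsHomogeneous (homogeneousSubmodule (Fin (3 + 1)) ℚ) ∧ IsUnmixedOfRank 𝔮 2 ∧ Q ∈ 𝔮 ∧
      P ∈ 𝔮 ∧ 𝔭.IsPrime ∧ 𝔭.IsHomogeneous (homogeneousSubmodule (Fin (3 + 1)) ℚ) ∧
      IsUnmixedOfRank 𝔭 1 ∧ 𝔮 ≤ 𝔭 ∧ T ∈ 𝔭 ∧ (ideg 𝔭 1 : ℝ) ≤ (c * Δ) ^ 3 ∧
      iheight 𝔭 1 ≤ c * Y * Δ ^ 2 ∧
      iabs 𝔭 1 (Fin.cons 1 ω) ≤ Real.exp (-((Δ * iheight 𝔭 1 + Y * ideg 𝔭 1) / c)) ∧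
      ((∀ s : ℕ, a + b + τ ≤ s → Module.finrank ℚ ↥(homogeneousSubmodule (Fin (3 + 1)) ℚ s) =
          Module.finrank ℚ ↥(homogeneousSubmodule (Fin (3 + 1)) ℚ s ⊓ 𝔭.restrictScalars ℚ) +
            ideg 𝔭 1) ∨
        (∃ 𝔯 ∈ associatedPrimes (Rx 3) (Rx 3 ⧸ (Ideal.span {Q} ⊔ Ideal.span {P})),
          𝔯 ≠ 𝔮 ∧ T ∈ 𝔯)) := by
  classical
  obtain ⟨c₂, hc₂, hS⟩ := hS ω
  obtain ⟨cB, hcB, hBox⟩ := boxPrinciple_modIdeal 3 ω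
  set ω₁ : Fin (3 + 1) → ℂ := Fin.cons 1 ω with hω₁def
  have hω₁ : ω₁ ≠ 0 := cons_one_ne_zero ω
  have hΘ : 1 ≤ ‖ω₁‖ := one_le_norm_cons_one ω
  -- the constant
  set c : ℝ := 5000 * (c₂ + 1) * (cB + 1) with hcdef
  have hprod : 0 ≤ c₂ * cB := by positivity
  have hc5000 : 5000 ≤ c := by rw [hcdef]; nlinarith [hprod]
  have hcc₂ : 5000 * c₂ ≤ c := by rw [hcdef]; nlinarith [hprod]
  have hccB : 5000 * cB ≤ c := by rw [hcdef]; nlinarith [hprod]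
  have hc1 : 1 ≤ c := by linarith
  have hc0 : 0 < c := by linarith
  refine ⟨c, hc1, fun Δ Y hΔ hY => ?_⟩
  have hΔ1 : 1 ≤ Δ := by linarith
  have hΔ0 : 0 < Δ := by linarith
  have hY0 : 0 ≤ Y := by linarith
  have hYpos : 0 < Y := by linarith
  -- (SPC3): the small prime space curve `𝔮 ⊇ (Q, P)`
  obtain ⟨Q, a, P, b, 𝔮, hQ0, hQhom, ha1, haΔ, hQprime, hPhom, hb1, hbΔ, hPQ, hqprime, hqhom,
    hqunm, hQq, hPq, hdeg, hh, habs⟩ := hS Δ Y (by linarith) hY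
  have hδ1n : 1 ≤ ideg 𝔮 2 :=
    Literature.Barriers.Schanuel.one_le_ideg_of_isPrime NesterenkoPhilippon2001_ch3_prop_4_4_holds
      (by norm_num) (by norm_num) hqprime hqhom hqunm
  set δ : ℝ := (ideg 𝔮 2 : ℝ) with hδdef
  have hδ1 : 1 ≤ δ := by rw [hδdef]; exact_mod_cast hδ1n
  have hδ0 : 0 < δ := by linarith
  set h : ℝ := iheight 𝔮 2 with hhdef
  have hh0 : 0 ≤ h := height_nonneg _
  have hX0 : 0 ≤ Δ * h + Y * δ := by positivity
  set S₂ : ℝ := Δ / c₂ * (Δ * h + Y * δ) with hS₂def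
  have hS₂0 : 0 ≤ S₂ := by rw [hS₂def]; positivity
  have hS₂X : S₂ ≤ Δ * (Δ * h + Y * δ) := by
    rw [hS₂def]
    exact mul_le_mul_of_nonneg_right (div_le_self hΔ0.le hc₂) hX0
  -- the degree `g = ⌊Δ⌋` of the extra factor and `b₃ = a + b + g`
  obtain ⟨g, hgdef⟩ : ∃ g : ℕ, g = ⌊Δ⌋₊ := ⟨_, rfl⟩
  obtain ⟨-, hg10, hgΔ, hΔg⟩ := CycleAPITwo.floor_facts haΔ (by linarith : (10 : ℝ) ≤ Δ)
  rw [← hgdef] at hg10 hgΔ hΔg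
  have hg0 : (0 : ℝ) < g := by exact_mod_cast (show 0 < g by omega)
  obtain ⟨b₃, hb₃def⟩ : ∃ b₃ : ℕ, b₃ = a + b + g := ⟨_, rfl⟩
  have hab : a + b ≤ b₃ := by omega
  have hb₃g : b₃ - a - b = g := by omega
  have hb₃1 : 1 ≤ b₃ := by omega
  have hb₃pos : 0 < b₃ := hb₃1
  have hb₃R : (b₃ : ℝ) ≤ 4 * Δ := by rw [hb₃def]; push_cast; linarith
  have hb₃0 : (0 : ℝ) ≤ b₃ := Nat.cast_nonneg _
  -- (H2): `M₃ = g deg 𝔮` free monomials of degree `b₃` modulo `𝔮`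
  have hdim : ringKrullDim (Rx 3 ⧸ 𝔮) = (2 : ℕ) :=
    ringKrullDim_quotient_eq_of_isUnmixedOfRank hqprime hqunm
  have hHilb := hH Q P a b hQ0 hQhom hPhom ha1 hb1 hQprime hPQ 𝔮 hqprime hqhom hQq hPq hdim b₃ hab
  obtain ⟨M₃, hM₃def⟩ : ∃ M : ℕ, M = g * ideg 𝔮 2 := ⟨_, rfl⟩
  rw [hb₃g, ← hM₃def] at hHilb
  have hM₃8 : 8 ≤ M₃ := by
    have : 10 * 1 ≤ g * ideg 𝔮 2 := Nat.mul_le_mul hg10 hδ1n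
    omega
  have hM₃R : (M₃ : ℝ) = (g : ℝ) * δ := by rw [hM₃def, Nat.cast_mul, hδdef]
  have hM₃8R : (8 : ℝ) ≤ M₃ := by exact_mod_cast hM₃8
  have hfin : finrank ℚ ↥(homogeneousSubmodule (Fin (3 + 1)) ℚ b₃ ⊓ 𝔮.restrictScalars ℚ) + M₃ ≤
      finrank ℚ ↥(homogeneousSubmodule (Fin (3 + 1)) ℚ b₃) := by
    have e : finrank ℚ ↥(homogeneousSubmodule (Fin (3 + 1)) ℚ b₃ ⊓ 𝔮.restrictScalars ℚ) =
        finrank ℚ ↥(idealDegree 𝔮 b₃) := by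
      rw [idealDegree, inf_comm]
    rw [e]
    omega
  have hqI : ∀ f ∈ 𝔮, ∀ d : ℕ, homogeneousComponent d f ∈ 𝔮 := fun f hf d =>
    MvPolynomial.homogeneousComponent_mem_of_mem hqhom hf d
  -- the adaptive height `h₃` and the box `N₃ = ⌊e^{h₃}⌋`
  set h₃ : ℝ := 4 * (S₂ + cB * (b₃ + 1)) / (g * δ) with hh₃def
  have hh₃0 : 0 ≤ h₃ := by rw [hh₃def]; positivity
  have hh₃eq : h₃ * (g * δ) = 4 * (S₂ + cB * (b₃ + 1)) := by
    rw [hh₃def]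
    exact div_mul_cancel₀ _ (by positivity)
  obtain ⟨N₃, hN₃def⟩ : ∃ N : ℕ, N = ⌊exp h₃⌋₊ := ⟨_, rfl⟩
  obtain ⟨hN1, hlogN, hlogN1⟩ := CycleAPITwo.box_facts hh₃0
  rw [← hN₃def] at hN1 hlogN hlogN1
  -- the third form `P₃ ∉ 𝔮`
  obtain ⟨P₃, hP₃q, hP₃hom, hP₃1, -, hhP₃, hP₃val⟩ := hBox 𝔮 b₃ N₃ M₃ hqI hN1 (by omega) hfin
  set hP : ℝ := height P₃ with hPdef
  have hP0 : 0 ≤ hP := height_nonneg _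
  have hPh₃ : hP ≤ h₃ := hhP₃.trans hlogN
  have hK : hP * δ ≤ 8 * (Δ * h + Y * δ) + 40 * cB := by
    have h1 : hP * δ ≤ h₃ * δ := mul_le_mul_of_nonneg_right hPh₃ hδ0.le
    have h2 := CycleAP3PrimeOfCurve.h3delta_le (cB := cB) (b₃ := (b₃ : ℝ)) hX0 hS₂X hcB hΔ1 hΔg
      hδ0 hb₃R
    rw [← hh₃def] at h2
    linarith
  -- smallness of the third form at `ω₁`
  have hnorm : normAt ω₁ P₃ ≤ exp (-S₂) := by
    have h1 : normAt ω₁ P₃ ≤ ‖aeval ω₁ P₃‖ := by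
      rw [normAt]
      exact div_le_self (norm_nonneg _) (one_le_mul_of_one_le_of_one_le hP₃1 (one_le_pow₀ hΘ))
    refine h1.trans (hP₃val.trans (exp_le_exp.mpr ?_))
    exact CycleAP3PrimeOfCurve.arith_box3 hS₂0 hcB hb₃0 hg0 hδ0 hM₃R hM₃8R hh₃eq hlogN1
  -- the cut
  set U₃ : ℝ := S₂ - (hP * δ + h * b₃ + 99 * δ * b₃) with hU₃def
  have hcut : hP * δ + h * b₃ + 99 * δ * b₃ + 54 * δ * b₃ ≤ S₂ / 2 :=
    CycleAP3PrimeOfCurve.arith_cut3 hc₂ (by linarith) (by linarith) hΔ hY hδ1 hh0 hb₃R hK hS₂def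
  have hδb : 0 ≤ δ * b₃ := by positivity
  have hU₃S : S₂ / 2 ≤ U₃ := by rw [hU₃def]; linarith
  have hE : height P₃ * (ideg 𝔮 2 : ℝ) + iheight 𝔮 2 * (b₃ : ℝ) +
      11 * ((3 : ℕ) : ℝ) ^ 2 * (ideg 𝔮 2 : ℝ) * (b₃ : ℝ) = hP * δ + h * b₃ + 99 * δ * b₃ := by
    rw [← hPdef, ← hhdef, ← hδdef]
    push_cast
    ring
  have hsmall : max (normAt ω₁ P₃) (iabs 𝔮 2 ω₁) *
      exp (height P₃ * (ideg 𝔮 2 : ℝ) + iheight 𝔮 2 * (b₃ : ℝ) +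
        11 * ((3 : ℕ) : ℝ) ^ 2 * (ideg 𝔮 2 : ℝ) * (b₃ : ℝ)) ≤ exp (-U₃) := by
    refine CycleAPITwo.max_mul_exp_le hnorm habs ?_ ?_ <;> linarith [hE, hU₃def]
  have hU₃54 : 2 * ((3 : ℕ) : ℝ) ^ 3 * ((ideg 𝔮 2 : ℝ) * (b₃ : ℝ)) ≤ U₃ := by
    rw [← hδdef]
    norm_num
    linarith
  obtain ⟨𝔭, h𝔭prime, h𝔭hom, h𝔭unm, hq𝔭, hP₃𝔭, h𝔭deg, h𝔭h, h𝔭abs⟩ :=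
    small_prime_of_cut 3 2 𝔮 P₃ b₃ ω₁ Δ Y U₃ le_rfl (by norm_num) hqprime hqhom hqunm hP₃hom hb₃1
      hP₃q hω₁ hΔ0.le hY0 (by linarith) hsmall hU₃54
  simp only [show (2 : ℕ) - 1 = 1 from rfl] at h𝔭unm h𝔭deg h𝔭h h𝔭abs
  rw [← hPdef, ← hhdef, ← hδdef] at h𝔭h h𝔭abs
  have h𝔭h0 : 0 ≤ iheight 𝔭 1 := height_nonneg _
  refine ⟨Q, a, P, b, P₃, b₃, 𝔮, 𝔭, hQ0, hQhom, ha1, haΔ, hQprime, hPhom, hb1, hbΔ, hPQ, hP₃hom,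
    hb₃1, hb₃R, hP₃q, hqprime, hqhom, hqunm, hQq, hPq, h𝔭prime, h𝔭hom, h𝔭unm, hq𝔭, hP₃𝔭, ?_, ?_,
    ?_, dichotomy hQ0 hQhom hPhom hP₃hom ha1 hb1 hb₃1 hQprime hPQ hP₃q hQq hPq h𝔭prime h𝔭hom
      h𝔭unm hq𝔭 hP₃𝔭⟩
  · -- degree budget `deg 𝔭 ≤ deg 𝔮 · b₃ ≤ 8Δ³ ≤ (cΔ)³`
    have h1 : (ideg 𝔭 1 : ℝ) ≤ δ * b₃ := by rw [hδdef]; exact_mod_cast h𝔭deg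
    exact h1.trans (CycleAP3PrimeOfCurve.arith_deg3 (by linarith) hΔ0.le hdeg hb₃0 hb₃R)
  · -- height budget
    have h1 : iheight 𝔭 1 ≤ h * b₃ + hP * δ + 18 * δ * b₃ := by
      refine h𝔭h.trans (le_of_eq ?_)
      push_cast
      ring
    exact h1.trans
      (CycleAP3PrimeOfCurve.arith_height3 (by linarith) hcB hΔ1 hY hδ0.le hdeg hh0 hh hb₃R hK)
  · -- accuracy at the registered rate `1/c`
    have hrate := CycleAP3PrimeOfCurve.arith_rate3 (hP := hP) hc₂ (by linarith) (by linarith) hΔ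
      hY hδ1 hh0 hb₃R hK hS₂def hU₃S
    have hb₃posR : (0 : ℝ) < b₃ := by exact_mod_cast hb₃pos
    refine h𝔭abs.trans (CycleAP3PrimeOfCurve.exp_rate_le hc0 ?_ ?_ ?_)
    · have h1 : 0 ≤ Δ * (h * b₃ + hP * δ + (3 * (2 + 1) + 3 ^ 2) * δ * b₃) := by positivity
      have h2 : 0 < Y * (δ * b₃) := mul_pos hYpos (mul_pos hδ0 hb₃posR)
      push_cast
      linarith
    · exact add_nonneg (mul_nonneg hΔ0.le h𝔭h0) (mul_nonneg hY0 (Nat.cast_nonneg _))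
    · refine le_trans (le_of_eq ?_) hrate
      push_cast
      ring

end CycleAP3Dichotomy

/-- **Registered stub `cycleAP3_dichotomy_of`** (crux `stmt-Schanuel-6117`, line
`orbit-interpolation-determinant`; the clause-free `t = 3` descent with its complete-intersection
information exposed): the small prime space curve (SPC3, neighbour stub `smallPrimeCurve3_of`) and
the curve Hilbert lower bound (H2, neighbour stub `curveHilbert_lowerBound`) give, for every `ω` and
all scales, the surface `Q`, the form `P`, the curve `𝔮`, the third form `T ∉ 𝔮` and the orbit
`𝔭 ⊇ 𝔮 + (T)` with the `CycleAP3Prime` bounds, together with the dichotomy: the interpolation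
clause for `𝔭` at every level `≥ a + b + τ` (`elim_ciSpace`), or an associated prime `𝔯 ≠ 𝔮` of
`S/(Q, P)` containing `T` (`CycleAP3Dichotomy.cut3_exposed`).
[cite: NesterenkoPhilippon2001, Ch. 3 Prop. 4.7, Prop. 4.11, Prop. 4.13 (pp. 39–41), §5 (p. 42)] -/
theorem cycleAP3_dichotomy_of : (∀ ω : Fin 3 → ℂ, ∃ c : ℝ, 1 ≤ c ∧ ∀ Δ Y : ℝ, c ≤ Δ → Δ ≤ Y → ∃ (Q : Rx 3) (a : ℕ) (P : Rx 3) (b : ℕ) (𝔮 : Ideal (Rx 3)), Q ≠ 0 ∧ Q.IsHomogeneous a ∧ 1 ≤ a ∧ (a : ℝ) ≤ Δ ∧ (Ideal.span {Q}).IsPrime ∧ P.IsHomogeneous b ∧ 1 ≤ b ∧ (b : ℝ) ≤ 2 * Δ ∧ P ∉ Ideal.span {Q} ∧ 𝔮.IsPrime ∧ 𝔮.IsHomogeneous (homogeneousSubmodule (Fin (3 + 1)) ℚ) ∧ IsUnmixedOfRank 𝔮 2 ∧ Q ∈ 𝔮 ∧ P ∈ 𝔮 ∧ (ideg 𝔮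 2 : ℝ) ≤ 2 * Δ ^ 2 ∧ iheight 𝔮 2 ≤ c * Δ * Y ∧ iabs 𝔮 2 (Fin.cons 1 ω) ≤ Real.exp (-(Δ / c * (Δ * iheight 𝔮 2 + Y * ideg 𝔮 2)))) → (∀ (Q P : Rx 3) (a b : ℕ), Q ≠ 0 → Q.IsHomogeneous a → P.IsHomogeneous b → 1 ≤ a → 1 ≤ b → (Ideal.span {Q}).IsPrime → P ∉ Ideal.span {Q} → ∀ 𝔭 : Ideal (Rx 3), 𝔭.IsPrime → (letI := MvPolynomial.gradedAlgebra (σ := Fin (3 + 1)) (R := ℚ); 𝔭.IsHomogeneous (MvPolynomial.homogeneousSubmodule (Fin (3 + 1)) ℚ)) → Q ∈ 𝔭 → P ∈ 𝔭 → ringKrullDim (Rx 3 ⧸ 𝔭) = (2 : ℕ) → ∀ ν : ℕ, a + b ≤ ν → (ν - a - b) * Literature.NumberTheory.Transcendental.Nesterenko.ideg 𝔭 2 + Module.finrank ℚ ↥(Literature.RingTheory.MvPolynomial.idealDegree 𝔭 ν) ≤ Module.finrank ℚ ↥(MvPolynomial.homogeneousSubmodule (Fin (3 + 1)) ℚ ν))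 → ∀ ω : Fin 3 → ℂ, ∃ c : ℝ, 1 ≤ c ∧ ∀ Δ Y : ℝ, c ≤ Δ → Δ ≤ Y → ∃ (Q : Rx 3) (a : ℕ) (P : Rx 3) (b : ℕ) (T : Rx 3) (τ : ℕ) (𝔮 𝔭 : Ideal (Rx 3)), Q ≠ 0 ∧ Q.IsHomogeneous a ∧ 1 ≤ a ∧ (a : ℝ) ≤ Δ ∧ (Ideal.span {Q}).IsPrime ∧ P.IsHomogeneous b ∧ 1 ≤ b ∧ (b : ℝ) ≤ 2 * Δ ∧ P ∉ Ideal.span {Q} ∧ T.IsHomogeneous τ ∧ 1 ≤ τ ∧ (τ : ℝ) ≤ 4 * Δ ∧ T ∉ 𝔮 ∧ 𝔮.IsPrime ∧ 𝔮.IsHomogeneous (homogeneousSubmodule (Fin (3 + 1)) ℚ) ∧ IsUnmixedOfRank 𝔮 2 ∧ Q ∈ 𝔮 ∧ P ∈ 𝔮 ∧ 𝔭.IsPrime ∧ 𝔭.IsHomogeneous (homogeneousSubmodule (Fin (3 + 1)) ℚ) ∧ IsUnmixedOfRank 𝔭 1 ∧ 𝔮 ≤ 𝔭 ∧ T ∈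 𝔭 ∧ (ideg 𝔭 1 : ℝ) ≤ (c * Δ) ^ 3 ∧ iheight 𝔭 1 ≤ c * Y * Δ ^ 2 ∧ iabs 𝔭 1 (Fin.cons 1 ω) ≤ Real.exp (-((Δ * iheight 𝔭 1 + Y * ideg 𝔭 1) / c)) ∧ ((∀ s : ℕ, a + b + τ ≤ s → Module.finrank ℚ ↥(homogeneousSubmodule (Fin (3 + 1)) ℚ s) = Module.finrank ℚ ↥(homogeneousSubmodule (Fin (3 + 1)) ℚ s ⊓ 𝔭.restrictScalars ℚ) + ideg 𝔭 1) ∨ (∃ 𝔯 ∈ associatedPrimes (Rx 3) (Rx 3 ⧸ (Ideal.span {Q} ⊔ Ideal.span {P})), 𝔯 ≠ 𝔮 ∧ T ∈ 𝔯)) := by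
  intro hS hH ω
  exact CycleAP3Dichotomy.cut3_exposed hS hH ω

end Summit.Schanuel.Schanuel.Cruxes.ApproximationProperty.OrbitInterpolationDeterminant

end
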